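import Literature.RepresentationTheory.FiniteGroups.NilpotentOperatorKernelFiltration
import Literature.Algebra.Homology.GroupCohomologyFreeOrbitFunctions
import Mathlib.Algebra.CharP.Lemmas
import HarnessLib

/-!
# The `p`-part step of Tate's Euler–Poincaré characteristic argument at the ambient level, I:
# `M`-valued functions on a `Q`-set fibred in `p`-cycles — `ψ (Maps(X, M)) = p • ψ (Maps(Y, M))`
# (Milne ADT I Lemma 2.10 / proof of Thm. 5.1; Serre, *Local Fields* IX §1)

Topic `RepresentationTheory/FiniteGroups`; namespace `Literature.RepresentationTheory.FiniteGroups`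
(sub-namespace `IndexPStep`).  THEOREMS ONLY (no definition, no named fact, no `sorry`, no
instance).  Sequel of `NilpotentOperatorKernelFiltration` (`ψ F = n • ψ (ker T)` for an equivariant
`T` with `Tⁿ = 0`, `#F = #(ker T)ⁿ`).

Milne, *Arithmetic Duality Theorems* (2006), proof of I Thm. 5.1 (p. 70) with Lemma 2.10 (p. 32):
after Artin induction one may "assume that `Ḡ` is a cyclic group", and the cyclic groups are
brought to order prime to `p` because a cyclic `p`-group contributes through
`𝔽_p[ℤ/p] = 𝔽_p[t]/(t-1)^p`, all of whose composition factors are trivial (Serre, *Local Fields*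
IX §1 Thm. 2, Cor.).  The lane «TATE-EPC-TC» (road memo `TATE-EPC-TC-ROAD`, evidence #54 on
stmt-BirchSwinnertonDyer-19032, brick B9) runs the whole reduction with ONE additive invariant `ψ`
of finite `p`-torsion `ℤ[Q]`-modules for the AMBIENT finite group `Q` (no Shapiro step, no change
of group), so the `p`-part step is needed in the form: for `C ≤ H ≤ Q` with `H` CYCLIC and
`[H : C] = p`, and `M` a finite `ℤ[Q]`-module killed by `p`,

  `ψ (Maps(Q/C, M)) = p • ψ (Maps(Q/H, M))`, equivalently `ψ (M ⊗ ℤ[Q/C]/p) = p • ψ (M ⊗ ℤ[Q/H]/p)`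

(diagonal actions).  PROOF.  Right translation `R : qC ↦ qhC` by a generator `h` of `H/C` is a
`Q`-equivariant permutation of `Q/C` whose orbits are the fibres of `Q/C → Q/H`, each of size `p`;
on `F = Maps(Q/C, M)` the operator `T = R^* − 1` is `Q`-equivariant with `T^p = R^{*p} − 1 = 0`
(`pM = 0`), `ker T = Maps(Q/H, M)` (functions constant on fibres) and `#F = #Maps(Q/H, M)^p`; so
`NilpotentOperatorKernelFiltration.additive_eq_smul_of_pow_eq_zero_of_card` applies.

THIS FILE: §1 the abstract `p`-cycle setting (`π : X → Y` equivariant, `R : X → X` equivariant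
generating the fibres): `sub_pow_prime_eq_zero` (`T^p = 0`), `ker_sub_eq_range` (`ker T = π^*`),
`natCard_eq_mul_of_cycle` (`#X = p·#Y`), **`additive_funRepr_eq_smul_of_cycle`**.  The coset
instance `X = Q/C`, `Y = Q/H` and the tensor currency `M ⊗ ℤ[X]/p` of the lane are the sequel
`PermutationModuleIndexPStep`.

## References
* J. S. Milne, *Arithmetic Duality Theorems*, 2nd ed. (2006), I Lemma 2.10 (p. 32), proof of
  Thm. 5.1 (p. 70). [MilneADT2006]
* J.-P. Serre, *Local Fields*, GTM 67 (1979), IX §1 Thm. 2 and Corollary. [Serre1979]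
* J.-P. Serre, *Linear Representations of Finite Groups*, GTM 42 (1977), §3.3, §15.2 Thm. 32.
  [SerreLinearRepresentations1977]
-/

noncomputable section

namespace Literature.RepresentationTheory.FiniteGroups

namespace IndexPStep

open Function LinearMap Submodule StableLatticeReduction
open Literature.Algebra.Homology (funRepr funRepr_apply)

variable {Q : Type} [Group Q] {A : Type*} [AddCommGroup A] {p : ℕ} [hp : Fact p.Prime]

/-! ### §1. The abstract `p`-cycle setting -/

section Cycle

variable {M : Type} [AddCommGroup M] (σ : Representation ℤ Q M)
variable {X Y : Type} [MulAction Q X] [MulAction Q Y]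
  (π : X → Y) (hπ : ∀ (g : Q) x, π (g • x) = g • π x) (hπs : Surjective π)
  (R : X → X) (hR : ∀ (g : Q) x, R (g • x) = g • R x) (hπR : ∀ x, π (R x) = π x)

omit hp in
include hπ in
/-- Pull-back along an equivariant map of `Q`-sets is `Q`-equivariant on `M`-valued functions.
[cite: SerreLinearRepresentations1977, §3.3] -/
theorem funLeft_funRepr (g : Q) (f : Y → M) :
    LinearMap.funLeft ℤ M π (funRepr σ Y g f) = funRepr σ X g (LinearMap.funLeft ℤ M π f) := by
  funext x
  rw [LinearMap.funLeft_apply, funRepr_apply, funRepr_apply, LinearMap.funLeft_apply, hπ]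

omit hp in
include hR in
/-- The operator `T = R^* − 1` is `Q`-equivariant. [cite: Serre1979, IX §1 Thm. 2, Corollary] -/
theorem sub_funRepr (g : Q) (f : X → M) :
    (LinearMap.funLeft ℤ M R - 1) (funRepr σ X g f) =
      funRepr σ X g ((LinearMap.funLeft ℤ M R - 1) f) := by
  rw [LinearMap.sub_apply, LinearMap.sub_apply, Module.End.one_apply, Module.End.one_apply, map_sub,
    funLeft_funRepr σ R hR]

omit hp in
/-- Powers of the pull-back: `(R^*)^i = (R^[i])^*`. [folklore] -/
private theorem funLeft_pow (i : ℕ) :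
    (LinearMap.funLeft ℤ M R) ^ i = LinearMap.funLeft ℤ M (R^[i]) := by
  induction i with
  | zero =>
    rw [pow_zero, Function.iterate_zero]
    exact LinearMap.ext fun f => (LinearMap.funLeft_id ℤ M f).symm
  | succ i ih =>
    rw [pow_succ, ih, Function.iterate_succ', LinearMap.funLeft_comp, Module.End.mul_eq_comp]

/-- **`T^p = 0`** for `T = R^* − 1` on `Maps(X, M)` when `R^[p] = id` and `pM = 0`:
`(R^* − 1)^p = R^{*p} − 1 + p·(…)`. [cite: Serre1979, IX §1 Thm. 2, Corollary] -/
theorem sub_pow_prime_eq_zero (hM : ∀ m : M, (p : ℤ) • m = 0) (hRp : ∀ x, R^[p] x = x) :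
    (LinearMap.funLeft ℤ M R - 1) ^ p = 0 := by
  set U : Module.End ℤ (X → M) := LinearMap.funLeft ℤ M R with hU
  have hUp : U ^ p = 1 := by
    rw [hU, funLeft_pow]
    exact LinearMap.ext fun f => funext fun x => by
      rw [LinearMap.funLeft_apply, hRp, Module.End.one_apply]
  obtain ⟨r, hr⟩ := (Commute.one_right U).neg_right.exists_add_pow_prime_eq hp.out
  rw [← sub_eq_add_neg] at hr
  have hpF : ∀ f : X → M, (p : Module.End ℤ (X → M)) f = 0 := fun f => by
    rw [Module.End.natCast_apply, ← Nat.cast_smul_eq_nsmul ℤ]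
    funext x
    exact hM (f x)
  refine LinearMap.ext fun f => ?_
  have h3 : ((p : Module.End ℤ (X → M)) * U * -1 * r) f = 0 := by
    rw [mul_assoc, mul_assoc, Module.End.mul_apply, hpF]
  rw [hr, hUp, LinearMap.add_apply, LinearMap.add_apply, h3, add_zero, LinearMap.zero_apply,
    Module.End.one_apply]
  -- `1 + (-1)^p = 0` or `= 2 = p`
  rcases hp.out.eq_two_or_odd' with h2 | hodd
  · subst h2
    have h2f := hpF f
    rw [Module.End.natCast_apply, two_nsmul] at h2f
    rwa [neg_one_sq, Module.End.one_apply]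
  · rw [hodd.neg_one_pow, LinearMap.neg_apply, Module.End.one_apply, add_neg_cancel]

include hπs hπR in
/-- **`ker (R^* − 1) = π^* Maps(Y, M)`**: a function is `R`-invariant iff it is constant on the
fibres of `π`, which are the `R`-orbits. [cite: Serre1979, IX §1 Thm. 2, Corollary] -/
theorem ker_sub_eq_range (hfib : ∀ x x', π x = π x' → ∃ i, x' = R^[i] x) :
    LinearMap.ker (LinearMap.funLeft ℤ M R - 1) = LinearMap.range (LinearMap.funLeft ℤ M π) := by
  ext f
  rw [LinearMap.mem_ker, LinearMap.mem_range, LinearMap.sub_apply, Module.End.one_apply, sub_eq_zero]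
  constructor
  · intro hf
    have hfR : ∀ x, f (R x) = f x := fun x => by
      have := congrFun hf x
      rwa [LinearMap.funLeft_apply] at this
    have hfi : ∀ i x, f (R^[i] x) = f x := by
      intro i
      induction i with
      | zero => intro x; rfl
      | succ i ih => intro x; rw [Function.iterate_succ_apply, ih, hfR]
    obtain ⟨s, hs⟩ := hπs.hasRightInverse
    refine ⟨fun y => f (s y), funext fun x => ?_⟩
    rw [LinearMap.funLeft_apply]
    obtain ⟨i, hi⟩ := hfib (s (π x)) x (hs (π x))
    conv_rhs => rw [hi]
    rw [hfi]
  · rintro ⟨g, rfl⟩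
    funext x
    rw [LinearMap.funLeft_apply, LinearMap.funLeft_apply, LinearMap.funLeft_apply, hπR]

include hπs hπR in
/-- **`#X = p · #Y`** when the fibres of `π` are `R`-cycles of length exactly `p`
(`(y, i) ↦ R^[i] (s y)` is a bijection `Y × Fin p ≃ X` for any section `s`).
[cite: Serre1979, IX §1] -/
theorem natCard_eq_mul_of_cycle [Finite Y] (hRp : ∀ x, R^[p] x = x)
    (hfib : ∀ x x', π x = π x' → ∃ i, x' = R^[i] x)
    (hfree : ∀ x i, 0 < i → i < p → R^[i] x ≠ x) : Nat.card X = Nat.card Y * p := by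
  obtain ⟨s, hs⟩ := hπs.hasRightInverse
  have hiter : ∀ i x, π (R^[i] x) = π x := fun i => by
    induction i with
    | zero => intro x; rfl
    | succ i ih => intro x; rw [Function.iterate_succ_apply', hπR, ih]
  -- reduce exponents mod `p`
  have hRpk : ∀ k x, R^[p * k] x = x := fun k => by
    induction k with
    | zero => intro x; rw [mul_zero, Function.iterate_zero_apply]
    | succ k ih => intro x; rw [Nat.mul_succ, Function.iterate_add_apply, hRp, ih]
  have hmod : ∀ i x, R^[i] x = R^[i % p] x := fun i x => by
    conv_lhs => rw [← Nat.mod_add_div i p]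
    rw [Function.iterate_add_apply, hRpk]
  let Φ : Y × Fin p → X := fun yi => R^[yi.2] (s yi.1)
  have hΦ : Bijective Φ := by
    constructor
    · rintro ⟨y, i⟩ ⟨y', j⟩ h
      have hy : y = y' := by
        have := congrArg π h
        simp only [Φ, hiter, hs y, hs y'] at this
        exact this
      subst hy
      -- `R^[i] z = R^[j] z` with `i, j < p` forces `i = j`
      simp only [Φ] at h
      have key : ∀ (a b : ℕ), a ≤ b → b < p → R^[a] (s y) = R^[b] (s y) → a = b := by
        intro a b hab hb he
        by_contra hne
        have hlt : 0 < b - a := Nat.sub_pos_of_lt (lt_of_le_of_ne hab hne)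
        apply hfree (R^[a] (s y)) (b - a) hlt (lt_of_le_of_lt (Nat.sub_le b a) hb)
        rw [← Function.iterate_add_apply, Nat.sub_add_cancel hab, ← he]
      rcases le_total (i : ℕ) j with hij | hji
      · exact Prod.ext rfl (Fin.ext (key i j hij j.2 h))
      · exact Prod.ext rfl (Fin.ext (key j i hji i.2 h.symm).symm)
    · intro x
      obtain ⟨i, hi⟩ := hfib (s (π x)) x (hs (π x))
      refine ⟨⟨π x, ⟨i % p, Nat.mod_lt _ hp.out.pos⟩⟩, ?_⟩
      simp only [Φ]
      rw [← hmod, ← hi]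
  haveI : Finite X := Finite.of_surjective Φ hΦ.2
  rw [← Nat.card_congr (Equiv.ofBijective Φ hΦ), Nat.card_prod, Nat.card_eq_fintype_card (α := Fin p),
    Fintype.card_fin]

variable (ψ : ∀ ⦃X : Type⦄ [AddCommGroup X] [Module ℤ X], Representation ℤ Q X → A)
  (hψ : ∀ ⦃X Y Z : Type⦄ [AddCommGroup X] [Module ℤ X] [AddCommGroup Y] [Module ℤ Y]
    [AddCommGroup Z] [Module ℤ Z] (ρX : Representation ℤ Q X) (ρY : Representation ℤ Q Y)
    (ρZ : Representation ℤ Q Z) (f : X →ₗ[ℤ] Y) (g : Y →ₗ[ℤ] Z),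
    (∀ s x, f (ρX s x) = ρY s (f x)) → (∀ s y, g (ρY s y) = ρZ s (g y)) →
    Injective f → Surjective g → LinearMap.range f = LinearMap.ker g → Finite Y →
    (∀ y : Y, (p : ℤ) • y = 0) → ψ ρY = ψ ρX + ψ ρZ)
include hψ

include hπ hπs hR hπR in
/-- **The abstract `p`-cycle step**: `ψ (Maps(X, M)) = p • ψ (Maps(Y, M))` when `π : X ↠ Y` is
equivariant and `R` is an equivariant self-map of `X` over `Y` whose orbits are the fibres, of
length exactly `p` (`M` finite, `pM = 0`, `Y` finite).
[cite: MilneADT2006, I Lemma 2.10 (p. 32)] [cite: Serre1979, IX §1 Thm. 2, Corollary] -/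
theorem additive_funRepr_eq_smul_of_cycle [Finite M] [Finite X] [Finite Y]
    (hM : ∀ m : M, (p : ℤ) • m = 0)
    (hRp : ∀ x, R^[p] x = x) (hfib : ∀ x x', π x = π x' → ∃ i, x' = R^[i] x)
    (hfree : ∀ x i, 0 < i → i < p → R^[i] x ≠ x) :
    ψ (funRepr σ X) = p • ψ (funRepr σ Y) := by
  obtain ⟨good_sub, good_quot, hψ'⟩ := StableLatticeReduction.Int.admissible ψ hψ
  have hX : Nat.card X = Nat.card Y * p := natCard_eq_mul_of_cycle π hπs R hπR hRp hfib hfree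
  set T : (X → M) →ₗ[ℤ] (X → M) := LinearMap.funLeft ℤ M R - 1 with hTdef
  have hT : ∀ s f, T (funRepr σ X s f) = funRepr σ X s (T f) := sub_funRepr σ R hR
  have hpF : ∀ f : X → M, (p : ℤ) • f = 0 := fun f => funext fun x => hM (f x)
  -- `ker T ≃ Maps(Y, M)`, equivariantly
  have hker := ker_sub_eq_range (M := M) π hπs R hπR hfib
  let e : (Y → M) ≃ₗ[ℤ] LinearMap.ker T :=
    (LinearEquiv.ofInjective (LinearMap.funLeft ℤ M π)
      (LinearMap.funLeft_injective_of_surjective _ _ π hπs)).trans (LinearEquiv.ofEq _ _ hker.symm)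
  have he : ∀ s f, e (funRepr σ Y s f) =
      (funRepr σ X).subrepresentation (LinearMap.ker T) (ker_le_comap_of_comm _ _ T hT) s (e f) :=
    fun s f => Subtype.ext (funLeft_funRepr σ π hπ s f)
  have hcardK : Nat.card (LinearMap.ker T) = Nat.card M ^ Nat.card Y := by
    rw [← Nat.card_congr e.toEquiv, Nat.card_fun]
  have hcard : Nat.card (X → M) = Nat.card (LinearMap.ker T) ^ p := by
    rw [hcardK, Nat.card_fun, hX, pow_mul]
  rw [KernelFiltration.additive_eq_smul_of_pow_eq_zero_of_card ψ hψ (funRepr σ X) hpF T hT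
    (sub_pow_prime_eq_zero R hM hRp) hcard]
  congr 1
  haveI : Finite (LinearMap.ker T) := inferInstance
  exact (Admissible.additive_eq_of_linearEquiv ψ _ good_quot hψ' (funRepr σ Y) _
    (good_sub _ _ (ker_le_comap_of_comm _ _ T hT) ⟨inferInstance, hpF⟩) e he).symm

end Cycle

end IndexPStep

end Literature.RepresentationTheory.FiniteGroups

end
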